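import Literature.IUT.HodgeTheaters.GlobalFrobenioidsCoricRigidityGenuineKummer
import HarnessLib

/-!
# [IUTchI] Example 5.1 (v), p. 127: "the `π₁^rat(†𝒟^⊛)`-action … necessarily factors (respectively, does not
# factor) through `π₁^rat(†𝒟^⊛) ↠ π₁^{κ-sol}(†𝒟^⊛)`" AT THE GENUINE ∞κ KUMMER CONTAINER (proof-only)

S. Mochizuki, *Inter-universal Teichmüller theory I*, kurims manuscript (May 2020), §5 Example 5.1 (v), p. 127
l. 30–35 and l. 47–75 ([IUTchI] Ex 5.1 (v) p.127) [claim: Mochizuki2012, status: disputed]: "Thus, the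
`π₁^rat(†𝒟^⊛)`-action that appears in an ∞κ-coric (respectively, ∞κ×-coric) structure necessarily factors
(respectively, does not factor) through the natural surjection `π₁^rat(†𝒟^⊛) ↠ π₁^{κ-sol}(†𝒟^⊛)` of (i)" and
"`𝕄^⊛_∞κ(†𝒟^⊚)` … is, in effect, constructed as a subset of `lim_{→ H} H¹(H, μ^Θ_Ẑ(π₁(†𝒟^⊚)))` … consideration of
Kummer classes … yields a natural injection of `†𝕄^⊛_∞κ` (respectively, `†𝕄^⊛_∞κ×`) into
`lim_{→ H} H¹(H, μ_Ẑ(†𝕄^⊛_∞κ))`".  LANA §6.1 pp. 31–32 [LANA2026Report]: the Kummer map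
`κ : M → lim_{→ H} H¹(H, Λ(M))` is `G`-equivariant for the natural action of `G` on `H¹`.

Cell abc-iut, D-0079 L-F sub-cell F6 («[IUTchI–IV] outside-cone FACT rows»), row **F-2006**
`Literature.IUT.HodgeTheaters.CoricPair.FactorsThrough` (abc-iut-L5-t1, `GlobalFrobenioidsKummer.lean` p405210;
FACT-LIST status «model-witness»: `NFBridgeRecon.infκPair_factorsThrough`, abc-iut-w5-d110 p413972, which holds
BY DEFINITION of `π₁^{rat/κ-sol}` as a subgroup of the kernel of the action on `𝕄^⊛_∞κ ⊆ K_rat`, p. 124);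
sub-DAG `plan/L5/SUBDAG-IUTchI-Ex51.md` rows E51/L22 (factors), E51/L23 (does not factor), E51/L25–L26 (the
container and the injection); node IUTchI:Ex5.1(v).  F6 action (plan/L5/F6-L5-XREF.tsv v1.3, abc-iut-L5-lead
13:34:00Z row «E51-FactorsThrough-genuine»): UPGRADE the model witness to the GENUINE ∞κ Kummer container of
abc-iut-f-190 (p443183) / abc-iut-w4-d056 (p432037): `†𝕄^⊛_∞κ` realised as genuine Kummer classes
`κ(f) ∈ lim_{→ i} H¹(S i, Λ(K_rat^×))` (L2 `kummerMap` / `H1Colimit`, any directed exhaustive system `S` of normal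
subgroups of `π₁^rat` [the open normal subgroups]) carrying the NATURAL `π₁^rat`-action on cohomology (L2
`CoMorphism.conjColimMap` / `conjColimMulAut`).  PROOF-ONLY: theorems, no `def`, no `instance`, no new `Prop`
fact; nothing of anyone's file is restated.

**What this file proves.**
* `CoricPair.factorsThrough_iff_of_injective` / `…_of_range_subset_fixed` / `KummerRealization.factorsThrough_iff`
  — factoring through `Γ ↠ Γ/N` is DETECTED in any container: for an injective equivariant map `φ : P → H`,
  `N` acts trivially on `P` iff `N` acts trivially on `φ(P)` (pure logic of [IUTchI] §0 pseudo-monoids realised in a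
  group, p. 33).
* `NFBridgeRecon.conjColimMap_kummerMap_of_mem_ratKsolKer` (+ `conjColimMulAut_…`, `…_mk0_…`) — **the genuine form of
  "factors through `π₁^{κ-sol}`"**: under the NATURAL Galois action on `lim_{→ i} H¹(S i, Λ(K_rat^×))`, every element of
  `π₁^{rat/κ-sol}(†𝒟^⊛)` FIXES the genuine Kummer class `κ(f)` of every ∞κ-coric rational function `f ∈ 𝕄^⊛_∞κ(†𝒟^⊚)` —
  from the `π₁^rat`-equivariance of the genuine Kummer map (L2 `CoMorphism.conjColimMap_kummerMap`, LANA §6.1) and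
  the definition of `π₁^{rat/κ-sol}` (p. 124); the only side condition is `hcoe` (the units action on `K_rat^×` is the
  field action), exactly as in p432037 / p443183.
* `NFBridgeRecon.factorsThrough_ratKsolKer_of_range_subset_kummerMap` — **F-2006 AT THE GENUINE CONTAINER**: EVERY
  pair `π₁^rat(†𝒟^⊛) ↷ P` admitting an injective `π₁^rat`-equivariant map into `lim_{→ i} H¹(S i, Λ(K_rat^×))` [natural
  action] with image inside the genuine Kummer classes `κ(𝕄^⊛_∞κ)` — print's "`†𝕄^⊛_∞κ ↪ lim_{→ H} H¹(H, μ_Ẑ(†𝕄^⊛_∞κ))`"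
  — satisfies the LITERAL predicate `P.FactorsThrough π₁^{rat/κ-sol}`; `…_of_kummerRealization` is the same over
  abc-iut-L5-t12's `CoricPair.KummerRealization` for any action instance agreeing with `conjColimMulAut` (`hact`).
  NO injectivity of the genuine Kummer map, NO structure isomorphism with the model is assumed.
* `NFBridgeRecon.isCoricStructure_infκPair_of_kummerRealization_range_eq` — GIVEN the printed injectivity of the
  genuine Kummer map (E51/L26), a pair Kummer-realised ONTO `κ(𝕄^⊛_∞κ)` IS an ∞κ-coric structure
  (abc-iut-L5-t12's `KummerRealization.isCoricStructure` against the genuine realisation of the model,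
  abc-iut-w4-d056's `kummerMap_mk0_realizes` / `kummerMap_mk0_smul`), so the model route
  (`IsCoricStructure.factorsThrough_ratKsolKer`, abc-iut-w5-d110) and the container route agree.
* `NFBridgeRecon.not_factorsThrough_ratKsolKer_of_kummerMap_range_subset` — the "respectively, does NOT factor"
  clause (E51/L23) at the genuine container: GIVEN Kummer injectivity (E51/L26) and the printed input `hmoves` (some
  element of `π₁^{rat/κ-sol}` moves some ∞κ×-coric function — Rmk 3.1.7 (ii)/(iii): the ∞κ×-coric functions contain
  the constants `F̄^×`; the SAME named input as abc-iut-w5-d110's `IsCoricStructure.not_factorsThrough_ratKsolKer`),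
  NO pair equivariantly embedded into the container with image CONTAINING `κ(𝕄^⊛_∞κ×)` factors through `π₁^{κ-sol}`.

HONEST FRAMING: kernel theorems about OUR typed interface `NFBridgeRecon` ([IUTchI] Ex. 5.1 (i) data) at OUR genuine
Kummer container; «genuine instance» = the predicate at the named container, never evidence for the universal
closure of the schema `FactorsThrough` (trivially refutable); no side is taken on [IUTchIII] Cor. 3.12; nothing of
the disputed series is asserted; typed ≠ proved; instantiated ≠ endorsed.
-/

namespace Literature.IUT.HodgeTheaters

open ProfiniteGrp ProfiniteGrp.ProfiniteCompletion
open Literature.AnabelianGeometry.EtaleTheta Literature.AnabelianGeometry.EtaleTheta.ZHatLevel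

universe u

/-! ### Factoring through a quotient is detected in any container ([IUTchI] §0 p. 33; Ex. 5.1 (v) p. 127) -/

section Generic

variable {Γ : Type u} [Group Γ] [TopologicalSpace Γ]

namespace CoricPair

/-- **Factoring through `Γ ↠ Γ/N` is detected by any injective equivariant map.**  If `φ : P → H` is injective
and intertwines the `Γ`-action on the pair `P` with self-maps `ρ g` of a container `H` (`φ(g·x) = ρ g (φ x)`),
then `N` acts trivially on `P` iff every `ρ n`, `n ∈ N`, fixes `φ(P)` pointwise.  [The shape of "consideration of
Kummer classes … yields a natural injection of `†𝕄^⊛_∞κ` into `lim_{→ H} H¹(H, μ_Ẑ(†𝕄^⊛_∞κ))`", p. 127: properties of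
the action on `†𝕄^⊛_∞κ` are read off inside the container.]  PROVED (pure logic).
([IUTchI] Ex 5.1 (v) p.127) [claim: Mochizuki2012, status: disputed] -/
theorem factorsThrough_iff_of_injective {P : CoricPair Γ} {H : Type*} (φ : P.carrier → H)
    (hinj : Function.Injective φ) (ρ : Γ → H → H) (hφ : ∀ (g : Γ) (x : P.carrier), φ (g • x) = ρ g (φ x))
    (N : Subgroup Γ) : P.FactorsThrough N ↔ ∀ n ∈ N, ∀ x : P.carrier, ρ n (φ x) = φ x := by
  constructor
  · intro h n hn x
    rw [← hφ, h n hn x]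
  · intro h n hn x
    exact hinj (by rw [hφ, h n hn x])

/-- **Sufficient form**: if the image of an injective equivariant map `φ : P → H` lies in a subset `T ⊆ H` fixed
pointwise by every `ρ n`, `n ∈ N`, then the `Γ`-action on `P` factors through `Γ ↠ Γ/N`.  PROVED.
([IUTchI] Ex 5.1 (v) p.127) [claim: Mochizuki2012, status: disputed] -/
theorem factorsThrough_of_range_subset_fixed {P : CoricPair Γ} {H : Type*} (φ : P.carrier → H)
    (hinj : Function.Injective φ) (ρ : Γ → H → H) (hφ : ∀ (g : Γ) (x : P.carrier), φ (g • x) = ρ g (φ x))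
    {N : Subgroup Γ} {T : Set H} (hT : ∀ n ∈ N, ∀ t ∈ T, ρ n t = t) (hrange : Set.range φ ⊆ T) :
    P.FactorsThrough N :=
  (factorsThrough_iff_of_injective φ hinj ρ hφ N).2 fun n hn x => hT n hn _ (hrange ⟨x, rfl⟩)

/-- **Kummer-realisation form** (abc-iut-L5-t12's `CoricPair.KummerRealization`: an injective, `Γ`-equivariant
map into a `Γ`-module `H` realising the pseudo-monoid structure): `N` acts trivially on the pair iff `N` acts
trivially on its Kummer classes.  PROVED. ([IUTchI] Ex 5.1 (v) p.127) [claim: Mochizuki2012, status: disputed] -/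
theorem KummerRealization.factorsThrough_iff {P : CoricPair Γ} {H : Type u} [CommGroup H] [MulAction Γ H]
    (κP : P.KummerRealization H) (N : Subgroup Γ) :
    P.FactorsThrough N ↔ ∀ n ∈ N, ∀ x : P.carrier, n • κP.toFun x = κP.toFun x :=
  factorsThrough_iff_of_injective κP.toFun κP.realizes.injective (fun g z => g • z) κP.smul N

/-- Kummer-realisation form, sufficient version: image inside an `N`-fixed subset of the container ⇒ the action
factors through `Γ ↠ Γ/N`.  PROVED. ([IUTchI] Ex 5.1 (v) p.127) [claim: Mochizuki2012, status: disputed] -/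
theorem KummerRealization.factorsThrough_of_range_subset {P : CoricPair Γ} {H : Type u} [CommGroup H]
    [MulAction Γ H] (κP : P.KummerRealization H) {N : Subgroup Γ} {T : Set H}
    (hT : ∀ n ∈ N, ∀ t ∈ T, n • t = t) (hrange : Set.range κP.toFun ⊆ T) : P.FactorsThrough N :=
  factorsThrough_of_range_subset_fixed κP.toFun κP.realizes.injective (fun g z => g • z) κP.smul hT hrange

end CoricPair

end Generic

/-! ### The genuine ∞κ Kummer container of the Ex. 5.1 (i) data (p. 127; LANA §6.1) -/

namespace NFBridgeRecon

variable (N : NFBridgeRecon.{0}) [MulDistribMulAction N.piRat N.Kratˣ] {ι : Type} [Preorder ι]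
  [DecidableEq ι] [IsDirectedOrder ι] (S : ι → Subgroup N.piRat) (hS : ∀ ⦃i j : ι⦄, i ≤ j → S j ≤ S i)
  [hN : ∀ i, (S i).Normal] [RootableBy N.Kratˣ ℕ]

omit [IsDirectedOrder ι] hN [RootableBy N.Kratˣ ℕ] in
/-- `π₁^{rat/κ-sol}(†𝒟^⊛)` fixes every UNIT of `K_rat` underlying an ∞κ-coric function (definition of `π₁^{rat/κ-sol}`,
p. 124, transported to `K_rat^×` along `hcoe`: the units action is the field action).  PROVED.
([IUTchI] Ex 5.1 (i) p.124) [claim: Mochizuki2012, status: disputed] -/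
theorem smul_units_eq_of_mem_ratKsolKer
    (hcoe : ∀ (g : N.piRat) (a : N.Kratˣ), ((g • a : N.Kratˣ) : N.Krat) = g • (a : N.Krat))
    {g : N.piRat} (hg : g ∈ N.ratKsolKer) {a : N.Kratˣ} (ha : (a : N.Krat) ∈ N.Minfκ) : g • a = a :=
  Units.ext (by rw [hcoe]; exact (Subgroup.mem_inf.mp hg).1 _ ha)

/-- **The genuine form of "factors through `π₁^rat ↠ π₁^{κ-sol}`" (p. 127 l. 30–35).**  Under the NATURAL action of
`π₁^rat(†𝒟^⊛)` on the genuine Kummer container `lim_{→ i} H¹(S i, Λ(K_rat^×))` (L2 `CoMorphism.conjColimMap`), every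
`g ∈ π₁^{rat/κ-sol}(†𝒟^⊛)` FIXES the genuine Kummer class `κ(a)` of every unit `a` underlying an ∞κ-coric rational
function: `g ⋆ κ(a) = κ(g · a) = κ(a)` — equivariance of the Kummer map (LANA §6.1, L2 `conjColimMap_kummerMap`) and
the definition of `π₁^{rat/κ-sol}`.  PROVED; no injectivity of `κ` is used.
([IUTchI] Ex 5.1 (v) p.127) [claim: Mochizuki2012, status: disputed] -/
theorem conjColimMap_kummerMap_of_mem_ratKsolKer
    (hcoe : ∀ (g : N.piRat) (a : N.Kratˣ), ((g • a : N.Kratˣ) : N.Krat) = g • (a : N.Krat))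
    (hc : IsExhausted N.Kratˣ S) {g : N.piRat} (hg : g ∈ N.ratKsolKer) {a : N.Kratˣ}
    (ha : (a : N.Krat) ∈ N.Minfκ) :
    CoMorphism.conjColimMap S hS g (kummerMap hS hc a) = kummerMap hS hc a := by
  rw [CoMorphism.conjColimMap_kummerMap, N.smul_units_eq_of_mem_ratKsolKer hcoe hg ha]

/-- The same on the elements `f ∈ 𝕄^⊛_∞κ(†𝒟^⊚)` of the model ∞κ-pair, with `κ(f) := κ(Units.mk0 f)` as in
abc-iut-w4-d056's genuine realisation (p432037): `g ⋆ κ(f) = κ(f)` for `g ∈ π₁^{rat/κ-sol}`.  PROVED.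
([IUTchI] Ex 5.1 (v) p.127) [claim: Mochizuki2012, status: disputed] -/
theorem conjColimMap_kummerMap_mk0_of_mem_ratKsolKer
    (hcoe : ∀ (g : N.piRat) (a : N.Kratˣ), ((g • a : N.Kratˣ) : N.Krat) = g • (a : N.Krat))
    (hc : IsExhausted N.Kratˣ S) {g : N.piRat} (hg : g ∈ N.ratKsolKer) (x : N.infκPair.carrier) :
    CoMorphism.conjColimMap S hS g (kummerMap hS hc (Units.mk0 (x : N.Krat) (N.coe_infκPair_ne_zero x))) =
      kummerMap hS hc (Units.mk0 (x : N.Krat) (N.coe_infκPair_ne_zero x)) :=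
  N.conjColimMap_kummerMap_of_mem_ratKsolKer S hS hcoe hc hg (by rw [Units.val_mk0]; exact x.2)

/-- **F-2006 `FactorsThrough` AT THE GENUINE ∞κ KUMMER CONTAINER (p. 127).**  For the Ex. 5.1 (i) data `N`, any
units action compatible with the field action (`hcoe`) and any directed exhaustive system `S` of normal subgroups of
`π₁^rat(†𝒟^⊛)`: EVERY pair `π₁^rat(†𝒟^⊛) ↷ P` [pseudo-monoid with continuous action] that admits an injective map
`φ : P → lim_{→ i} H¹(S i, Λ(K_rat^×))`, equivariant for the NATURAL Galois action on cohomology, with image inside the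
genuine Kummer classes `κ(𝕄^⊛_∞κ(†𝒟^⊚))` — "`†𝕄^⊛_∞κ ↪ lim_{→ H} H¹(H, μ_Ẑ(†𝕄^⊛_∞κ))`" — has `π₁^rat`-action FACTORING
THROUGH `π₁^rat(†𝒟^⊛) ↠ π₁^{κ-sol}(†𝒟^⊛)`, i.e. satisfies the literal predicate `P.FactorsThrough π₁^{rat/κ-sol}`.
PROVED; neither the injectivity of the genuine Kummer map nor a structure isomorphism with the model is assumed.
([IUTchI] Ex 5.1 (v) p.127) [claim: Mochizuki2012, status: disputed] -/
theorem factorsThrough_ratKsolKer_of_range_subset_kummerMap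
    (hcoe : ∀ (g : N.piRat) (a : N.Kratˣ), ((g • a : N.Kratˣ) : N.Krat) = g • (a : N.Krat))
    (hc : IsExhausted N.Kratˣ S) {P : CoricPair N.piRat} (φ : P.carrier → H1Colimit N.Kratˣ S hS)
    (hinj : Function.Injective φ)
    (hφ : ∀ (g : N.piRat) (x : P.carrier), φ (g • x) = CoMorphism.conjColimMap S hS g (φ x))
    (hrange : ∀ x : P.carrier, ∃ a : N.Kratˣ, (a : N.Krat) ∈ N.Minfκ ∧ φ x = kummerMap hS hc a) :
    P.FactorsThrough N.ratKsolKer := by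
  refine CoricPair.factorsThrough_of_range_subset_fixed φ hinj (fun g z => CoMorphism.conjColimMap S hS g z) hφ
    (T := {z | ∃ a : N.Kratˣ, (a : N.Krat) ∈ N.Minfκ ∧ z = kummerMap hS hc a}) ?_ ?_
  · rintro n hn z ⟨a, ha, rfl⟩
    exact N.conjColimMap_kummerMap_of_mem_ratKsolKer S hS hcoe hc hn ha
  · rintro z ⟨x, rfl⟩
    exact hrange x

variable [Nonempty ι]

/-- Multiplicative form of `conjColimMap_kummerMap_of_mem_ratKsolKer` for the packaged action
`CoMorphism.conjColimMulAut : π₁^rat →* MulAut (Multiplicative (lim_{→} H¹))` (L2) and `κ := ofAdd ∘ kummerMap`: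
`g ⋆ κ(a) = κ(a)` for `g ∈ π₁^{rat/κ-sol}`, `a ∈ 𝕄^⊛_∞κ`.  PROVED. ([IUTchI] Ex 5.1 (v) p.127)
[claim: Mochizuki2012, status: disputed] -/
theorem conjColimMulAut_kummerMap_of_mem_ratKsolKer
    (hcoe : ∀ (g : N.piRat) (a : N.Kratˣ), ((g • a : N.Kratˣ) : N.Krat) = g • (a : N.Krat))
    (hc : IsExhausted N.Kratˣ S) {g : N.piRat} (hg : g ∈ N.ratKsolKer) {a : N.Kratˣ}
    (ha : (a : N.Krat) ∈ N.Minfκ) :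
    CoMorphism.conjColimMulAut S hS g (Multiplicative.ofAdd (kummerMap hS hc a)) =
      Multiplicative.ofAdd (kummerMap hS hc a) := by
  rw [CoMorphism.conjColimMulAut_ofAdd_kummerMap, N.smul_units_eq_of_mem_ratKsolKer hcoe hg ha]

/-- **F-2006 over abc-iut-L5-t12's `KummerRealization`.**  For ANY action instance of `π₁^rat` on the multiplicatively
written genuine container `Multiplicative (lim_{→ i} H¹(S i, Λ(K_rat^×)))` that agrees with the natural one (`hact`):
every pair `P` with a Kummer realisation whose image lies inside the genuine Kummer classes of `𝕄^⊛_∞κ(†𝒟^⊚)`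
[`x ↦ ofAdd (κ (Units.mk0 x))`, abc-iut-w4-d056 p432037] satisfies `P.FactorsThrough π₁^{rat/κ-sol}`.  PROVED.
([IUTchI] Ex 5.1 (v) p.127) [claim: Mochizuki2012, status: disputed] -/
theorem factorsThrough_ratKsolKer_of_kummerRealization
    (hcoe : ∀ (g : N.piRat) (a : N.Kratˣ), ((g • a : N.Kratˣ) : N.Krat) = g • (a : N.Krat))
    (hc : IsExhausted N.Kratˣ S) [MulAction N.piRat (Multiplicative (H1Colimit N.Kratˣ S hS))]
    (hact : ∀ (g : N.piRat) (z : Multiplicative (H1Colimit N.Kratˣ S hS)),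
      g • z = CoMorphism.conjColimMulAut S hS g z)
    {P : CoricPair N.piRat} (κP : P.KummerRealization (Multiplicative (H1Colimit N.Kratˣ S hS)))
    (hrange : Set.range κP.toFun ⊆ Set.range (fun x : N.infκPair.carrier =>
      Multiplicative.ofAdd (kummerMap hS hc (Units.mk0 (x : N.Krat) (N.coe_infκPair_ne_zero x))))) :
    P.FactorsThrough N.ratKsolKer := by
  refine κP.factorsThrough_of_range_subset ?_ hrange
  rintro n hn z ⟨x, rfl⟩
  rw [hact]
  exact N.conjColimMulAut_kummerMap_of_mem_ratKsolKer S hS hcoe hc hn (by rw [Units.val_mk0]; exact x.2)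

/-- **Container route = model route** (p. 127 l. 57–75; E51/L26 "the asserted injectivity").  GIVEN the injectivity
of the genuine Kummer map on `K_rat^×`, a pair `P` Kummer-realised (for an action agreeing with the natural one)
ONTO the genuine Kummer classes of `𝕄^⊛_∞κ(†𝒟^⊚)` IS an ∞κ-coric structure on `†ℱ^⊛` — abc-iut-L5-t12's
`KummerRealization.isCoricStructure` against the GENUINE realisation of the model pair (abc-iut-w4-d056's
`kummerMap_mk0_realizes` / `kummerMap_mk0_smul`).  PROVED. ([IUTchI] Ex 5.1 (v) p.127)
[claim: Mochizuki2012, status: disputed] -/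
theorem isCoricStructure_infκPair_of_kummerRealization_range_eq
    (hcoe : ∀ (g : N.piRat) (a : N.Kratˣ), ((g • a : N.Kratˣ) : N.Krat) = g • (a : N.Krat))
    (hc : IsExhausted N.Kratˣ S) (hinjκ : Function.Injective (kummerMap hS hc))
    [MulAction N.piRat (Multiplicative (H1Colimit N.Kratˣ S hS))]
    (hact : ∀ (g : N.piRat) (z : Multiplicative (H1Colimit N.Kratˣ S hS)),
      g • z = CoMorphism.conjColimMulAut S hS g z)
    {P : CoricPair N.piRat} (κP : P.KummerRealization (Multiplicative (H1Colimit N.Kratˣ S hS)))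
    (hrange : Set.range κP.toFun = Set.range (fun x : N.infκPair.carrier =>
      Multiplicative.ofAdd (kummerMap hS hc (Units.mk0 (x : N.Krat) (N.coe_infκPair_ne_zero x))))) :
    IsCoricStructure N.piRat N.infκPair P := by
  -- the GENUINE Kummer realisation of the model ∞κ-pair, for the given (= natural) action instance
  let κ₀ : N.infκPair.KummerRealization (Multiplicative (H1Colimit N.Kratˣ S hS)) :=
    { toFun := fun x => Multiplicative.ofAdd
        (kummerMap hS hc (Units.mk0 (x : N.Krat) (N.coe_infκPair_ne_zero x)))
      realizes := N.kummerMap_mk0_realizes S hS hc hinjκ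
      smul := fun g x => by rw [hact]; exact N.kummerMap_mk0_smul S hS hcoe hc g x }
  exact CoricPair.KummerRealization.isCoricStructure κP κ₀ hrange

/-- Hence (same hypotheses) such a pair factors through `π₁^{κ-sol}` ALSO by the model route
(abc-iut-w5-d110's `IsCoricStructure.factorsThrough_ratKsolKer`) — the two routes agree.  PROVED.
([IUTchI] Ex 5.1 (v) p.127) [claim: Mochizuki2012, status: disputed] -/
theorem factorsThrough_ratKsolKer_of_kummerRealization_range_eq
    (hcoe : ∀ (g : N.piRat) (a : N.Kratˣ), ((g • a : N.Kratˣ) : N.Krat) = g • (a : N.Krat))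
    (hc : IsExhausted N.Kratˣ S) (hinjκ : Function.Injective (kummerMap hS hc))
    [MulAction N.piRat (Multiplicative (H1Colimit N.Kratˣ S hS))]
    (hact : ∀ (g : N.piRat) (z : Multiplicative (H1Colimit N.Kratˣ S hS)),
      g • z = CoMorphism.conjColimMulAut S hS g z)
    {P : CoricPair N.piRat} (κP : P.KummerRealization (Multiplicative (H1Colimit N.Kratˣ S hS)))
    (hrange : Set.range κP.toFun = Set.range (fun x : N.infκPair.carrier =>
      Multiplicative.ofAdd (kummerMap hS hc (Units.mk0 (x : N.Krat) (N.coe_infκPair_ne_zero x))))) :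
    P.FactorsThrough N.ratKsolKer :=
  IsCoricStructure.factorsThrough_ratKsolKer N
    (N.isCoricStructure_infκPair_of_kummerRealization_range_eq S hS hcoe hc hinjκ hact κP hrange)

omit [Nonempty ι] in
/-- **"(respectively, does NOT factor)" AT THE GENUINE CONTAINER (p. 127 l. 30–35; E51/L23).**  GIVEN the injectivity
of the genuine Kummer map on `K_rat^×` (E51/L26) and the printed input `hmoves` — some element of
`π₁^{rat/κ-sol}(†𝒟^⊛)` moves some ∞κ×-coric rational function [Rmk 3.1.7 (ii)/(iii): the ∞κ×-coric functions contain
the constants `F̄^×`; the same named input as abc-iut-w5-d110's `IsCoricStructure.not_factorsThrough_ratKsolKer`] —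
NO pair `π₁^rat(†𝒟^⊛) ↷ P` mapped equivariantly into `lim_{→ i} H¹(S i, Λ(K_rat^×))` [natural action] with image
CONTAINING the genuine Kummer classes `κ(𝕄^⊛_∞κ×(†𝒟^⊚))` has action factoring through `π₁^{κ-sol}(†𝒟^⊛)`.  PROVED
(injectivity of `φ` is not even needed).  ([IUTchI] Ex 5.1 (v) p.127) [claim: Mochizuki2012, status: disputed] -/
theorem not_factorsThrough_ratKsolKer_of_kummerMap_range_subset
    (hcoe : ∀ (g : N.piRat) (a : N.Kratˣ), ((g • a : N.Kratˣ) : N.Krat) = g • (a : N.Krat))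
    (hc : IsExhausted N.Kratˣ S) (hinjκ : Function.Injective (kummerMap hS hc))
    (hmoves : ∃ g ∈ N.ratKsolKer, ∃ f ∈ N.Minfκx, g • f ≠ f)
    {P : CoricPair N.piRat} (φ : P.carrier → H1Colimit N.Kratˣ S hS)
    (hφ : ∀ (g : N.piRat) (x : P.carrier), φ (g • x) = CoMorphism.conjColimMap S hS g (φ x))
    (hsurj : ∀ a : N.Kratˣ, (a : N.Krat) ∈ N.Minfκx → ∃ x : P.carrier, φ x = kummerMap hS hc a) :
    ¬ P.FactorsThrough N.ratKsolKer := by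
  rintro hP
  obtain ⟨g, hg, f, hf, hne⟩ := hmoves
  have hf0 : f ≠ 0 := fun h => N.zero_notMem (h ▸ hf)
  obtain ⟨x, hx⟩ := hsurj (Units.mk0 f hf0) (by rw [Units.val_mk0]; exact hf)
  have hfix : CoMorphism.conjColimMap S hS g (kummerMap hS hc (Units.mk0 f hf0)) =
      kummerMap hS hc (Units.mk0 f hf0) := by
    rw [← hx, ← hφ, hP g hg x]
  rw [CoMorphism.conjColimMap_kummerMap] at hfix
  have hunit : g • Units.mk0 f hf0 = Units.mk0 f hf0 := hinjκ hfix
  apply hne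
  have hval := congrArg (fun u : N.Kratˣ => (u : N.Krat)) hunit
  simp only [hcoe, Units.val_mk0] at hval
  exact hval

end NFBridgeRecon

end Literature.IUT.HodgeTheaters
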